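import Literature.AlgebraicGeometry.Frobenioids.BaseCategoryTheoreticityInstancesClosed
import Literature.AlgebraicGeometry.Frobenioids.BaseCategoryTheoreticityProofs
import Literature.AlgebraicGeometry.Frobenioids.EquivalenceIstrSquare
import Literature.AlgebraicGeometry.Frobenioids.EquivalenceThm34ivvOfThm34iii
import Literature.AlgebraicGeometry.Frobenioids.ModelFrobenioidBaseSection
import Literature.AlgebraicGeometry.Frobenioids.UnitEquivalenceProofs
import Literature.AlgebraicGeometry.Frobenioids.ElemFrobenioidEquivalenceProofs
import HarnessLib

/-!
# Frobenioids I, Theorem 3.4: the typed schemata `HypB`, `PreservesDegFr`, `OneUniqueSquare` of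
# `BaseCategoryTheoreticity.lean` and `IsFrobeniusSection` of `BaseFrobeniusSections.lean`, AT THE FROBENIOIDS,
# with the FACT declaration as the HEAD of each conclusion (PROOF-ONLY)

Mochizuki, *The geometry of Frobenioids I: the general theory*, Kyushu J. Math. **62** (2008) 293–400, kurims text:
Thm. 3.4 (i) p. 62 ll. 20–27 («there exists a 1-unique functor Ψistr … that fits into a 1-commutative diagram»),
(iii) p. 62 ll. 31–61, (iv) p. 62 l. 62 – p. 63 l. 21 («ΨN≥1 is the identity automorphism»), (v) p. 63 ll. 22–37
(«there exists a 1-unique functor ΨBase»), Remark 3.4.1 p. 69, Thm. 5.2 (ii) proof p. 101 (the zero section of a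
model Frobenioid) [cite: MochizukiFrdI2008, Thm. 3.4 pp.62-63].

PROOF-ONLY closer (0 definitions; cell abc-iut, D-0079 ORIGINAL-L sub-cell L-F [FrdI/II], pack B, seat abc-iut-L1-t13;
FACT-LIST rows F-0893 `PreFrobenioidData.HypB`, F-0895 `PreFrobenioidData.PreservesDegFr`, F-0894
`PreFrobenioidData.OneUniqueSquare`, F-2304 `PreFrobenioid.IsFrobeniusSection`).  These four rows are PARAMETRISED
predicates whose universal closures are refuted in tree (`not_forall_hypB`, `not_forall_preservesDegFr`,
`not_forall_oneUniqueSquare`, `not_forall_isFrobeniusSection`); what print asserts are their INSTANCE forms at the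
Frobenioids, and every ingredient is already a theorem of the tree (abc-iut-L1-t11 `FrdI.Thm34ii/iii/iv/v_holds`,
abc-iut-L1-t3 `FrdI.Remark341_holds`, abc-iut-f-019 `FrdI.thm34iv_ofFunctor` / `thm34v_ofFunctor` /
`thm34iv_untr_ofFunctor'` / `thm34iii_pf_ofFunctor_of_isOfPerfectType`, abc-iut-w5-d061's
`PreFrobenioid.thm34i_istr_ofFunctor`, abc-iut-L1's `ModelFrobenioid.isBaseFrobeniusPair_zero`).  This file only
KNITS them so that each FACT declaration appears as the HEAD of an unconditional theorem (the shape the cell's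
head-matcher consumes), with exactly the printed standing hypotheses as binders:

* `FrdI.hypB_ofFunctor_of_preservesDegFr` — hypothesis (b) for group-like quasi-isotropic Frobenioids whose `Ψ`,
  `Ψ⁻¹` preserve Frobenius degrees (= Remark 3.4.1); the non-group-like case is the pure-logic
  `Literature.AnabelianGeometry.EtaleTheta.hypB_of_not_isOfGroupLikeType` (not restated);
* `FrdI.preservesDegFr_ofFunctor_of_not_isGroupLikeObj` ((iii): `ΨN≥1 = id` when both sides have a non-group-like
  object) and `FrdI.preservesDegFr_ofFunctor_of_isFrobeniusSlim` ((iv), `D₂` Frobenius-slim);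
* `FrdI.oneUniqueSquare_base_ofFunctor` ((v), the `ΨBase` square), `FrdI.oneUniqueSquare_istr_ofFunctor` ((i), the
  `Ψistr` square at THE isotropifications), `FrdI.oneUniqueSquare_untr_ofFunctor` ((iv), the `Ψun-tr` square at THE
  `Ψistr`), `FrdI.oneUniqueSquare_pf_ofFunctor_of_isOfPerfectType` ((iii), the `Ψpf` square at THE perfections,
  perfect type — outside perfect type the bare `1`-uniqueness is refuted, `DegreeModel.not_thm34iii_pf`), each at the
  functor the corresponding instance theorem provides (`Exists.choose`);
* `ModelFrobenioid.isFrobeniusSection_zero` — the zero Frobenius section of ANY model Frobenioid over a skeletal base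
  with divisorial `Φ` and group-like `B` (field of `isBaseFrobeniusPair_zero`).

Nothing of the paper is restated or strengthened; no schema is re-declared; nothing here bears on [IUTchIII] Cor. 3.12;
typed ≠ proved-in-print — here proved = kernel-checked composition of tree theorems.

v2 (append-only; rows F-0900 `PreFrobenioidData.Thm34i`, F-0899 `PreFrobenioidData.Remark341`, F-0916 `Frobenioids.Prop33ii`,
F-0919 `Frobenioids.Prop33v`, F-0896 `PreFrobenioidData.Prop311i`): the head-forms at `ofFunctor` of the 0-ary named facts
`FrdI.Thm34i_holds` / `FrdI.Remark341_holds` (abc-iut-L1-t3, `BaseCategoryTheoreticityProofs.lean`), `FrdI.Prop33ii_holds` /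
`FrdI.Prop311i_holds` (`UnitEquivalenceProofs.lean`), `FrdI.Prop33v_holds` (`ElemFrobenioidEquivalenceProofs.lean`) — one line
each, for EVERY Frobenioid (pair) and every equivalence; v1 declarations byte-identical.
-/

namespace Literature.AlgebraicGeometry.Frobenioids

open CategoryTheory PreFrobenioidData

universe w v v' u u'

namespace FrdI

section Two

variable {D₁ : Type u} [Category.{v} D₁] {Φ₁ : D₁ᵒᵖ ⥤ CommMonCat.{w}} {C₁ : Type u'} [Category.{v'} C₁]
  {D₂ : Type u} [Category.{v} D₂] {Φ₂ : D₂ᵒᵖ ⥤ CommMonCat.{w}} {C₂ : Type u'} [Category.{v'} C₂]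
  {F₁ : C₁ ⥤ ElemFrobenioid Φ₁} {F₂ : C₂ ⥤ ElemFrobenioid Φ₂}

/-! ### F-0893 `HypB` — the group-like case (Remark 3.4.1) -/

/-- **Hypothesis (b) of Thm. 3.4 (iii)–(v) AT THE FROBENIOIDS, group-like quasi-isotropic case**: if `C₁`, `C₂` are
of quasi-isotropic type and `Ψ`, `Ψ⁻¹` preserve Frobenius degrees, then «both Ψ and some quasi-inverse to Ψ preserve
base-isomorphisms» whenever `C₁`, `C₂` are of group-like type — i.e. `HypB` holds (Remark 3.4.1, the tree's theorem
`FrdI.Remark341_holds`). [cite: MochizukiFrdI2008, Rem. 3.4.1 p.69] -/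
theorem hypB_ofFunctor_of_preservesDegFr (hF₁ : PreFrobenioid.IsFrobenioid F₁)
    (hF₂ : PreFrobenioid.IsFrobenioid F₂) (Ψ : C₁ ≌ C₂)
    (hq₁ : (ofFunctor Φ₁ F₁).IsOfQuasiIsotropicType) (hq₂ : (ofFunctor Φ₂ F₂).IsOfQuasiIsotropicType)
    (hd : PreservesDegFr (ofFunctor Φ₁ F₁) (ofFunctor Φ₂ F₂) Ψ)
    (hd' : PreservesDegFr (ofFunctor Φ₂ F₂) (ofFunctor Φ₁ F₁) Ψ.symm) :
    HypB (ofFunctor Φ₁ F₁) (ofFunctor Φ₂ F₂) Ψ :=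
  fun hg₁ hg₂ => Remark341_holds F₁ F₂ hF₁ hF₂ Ψ hg₁ hg₂ hq₁ hq₂ hd hd'

/-! ### F-0895 `PreservesDegFr` -/

/-- **«ΨN≥1 is the identity» AT THE FROBENIOIDS, from Thm. 3.4 (iii)**: under (a) standard type and (b) `HypB`, if
both `C₁` and `C₂` admit a non-group-like object then `Ψ` preserves Frobenius degrees (the automorphism `ΨN≥1` of
(iii) is the identity; `FrdI.Thm34iii_holds`). [cite: MochizukiFrdI2008, Thm. 3.4 (iii) p.62] -/
theorem preservesDegFr_ofFunctor_of_not_isGroupLikeObj (hF₁ : PreFrobenioid.IsFrobenioid F₁)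
    (hF₂ : PreFrobenioid.IsFrobenioid F₂) (Ψ : C₁ ≌ C₂)
    (hs₁ : (ofFunctor Φ₁ F₁).IsOfStandardType) (hs₂ : (ofFunctor Φ₂ F₂).IsOfStandardType)
    (hB : HypB (ofFunctor Φ₁ F₁) (ofFunctor Φ₂ F₂) Ψ)
    (hN₁ : ∃ A : C₁, ¬ (ofFunctor Φ₁ F₁).IsGroupLikeObj A) (hN₂ : ∃ A : C₂, ¬ (ofFunctor Φ₂ F₂).IsGroupLikeObj A) :
    PreservesDegFr (ofFunctor Φ₁ F₁) (ofFunctor Φ₂ F₂) Ψ := by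
  obtain ⟨-, ΨN, hΨN, hid⟩ := Thm34iii_holds F₁ F₂ hF₁ hF₂ Ψ hs₁ hs₂ hB
  intro A B φ
  rw [hΨN φ, hid hN₁ hN₂]
  rfl

/-- **«Ψ preserves Frobenius degrees» AT THE FROBENIOIDS, Thm. 3.4 (iv) form**: under (a), (b) and `D₂`
Frobenius-slim, `Ψ` preserves Frobenius degrees — abc-iut-L1-t11's `preservesDegFr_of_thm34ii_thm34iii` fed with the
tree's theorems `FrdI.Thm34ii_holds`, `FrdI.Thm34iii_holds` for `Ψ` and `Ψ⁻¹`. [cite: MochizukiFrdI2008, Thm. 3.4 (iv) p.63] -/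
theorem preservesDegFr_ofFunctor_of_isFrobeniusSlim (hF₁ : PreFrobenioid.IsFrobenioid F₁)
    (hF₂ : PreFrobenioid.IsFrobenioid F₂) (Ψ : C₁ ≌ C₂)
    (hs₁ : (ofFunctor Φ₁ F₁).IsOfStandardType) (hs₂ : (ofFunctor Φ₂ F₂).IsOfStandardType)
    (hB : HypB (ofFunctor Φ₁ F₁) (ofFunctor Φ₂ F₂) Ψ) (hslim₂ : IsFrobeniusSlim D₂) :
    PreservesDegFr (ofFunctor Φ₁ F₁) (ofFunctor Φ₂ F₂) Ψ :=
  preservesDegFr_of_thm34ii_thm34iii hF₁ hF₂ Ψ (Thm34ii_holds F₁ F₂ hF₁ hF₂ Ψ)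
    (Thm34ii_holds F₂ F₁ hF₂ hF₁ Ψ.symm) (Thm34iii_holds F₁ F₂ hF₁ hF₂ Ψ) (Thm34iii_holds F₂ F₁ hF₂ hF₁ Ψ.symm)
    hs₁ hs₂ hB hslim₂

/-! ### F-0894 `OneUniqueSquare` — the four squares of Thm. 3.4 at the functors the instance theorems provide -/

/-- **The `ΨBase` square of Thm. 3.4 (v) AT THE FROBENIOIDS**: under (a), (b) and slim bases, the functor
`ΨBase : D₁ ⥤ D₂` provided by `FrdI.thm34v_ofFunctor` is an equivalence fitting a `1`-commutative, `1`-unique square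
`ΨBase ∘ Base₁ ≅ Base₂ ∘ Ψ`. [cite: MochizukiFrdI2008, Thm. 3.4 (v) p.63] -/
theorem oneUniqueSquare_base_ofFunctor (hF₁ : PreFrobenioid.IsFrobenioid F₁) (hF₂ : PreFrobenioid.IsFrobenioid F₂)
    (Ψ : C₁ ≌ C₂) (hs₁ : (ofFunctor Φ₁ F₁).IsOfStandardType) (hs₂ : (ofFunctor Φ₂ F₂).IsOfStandardType)
    (hB : HypB (ofFunctor Φ₁ F₁) (ofFunctor Φ₂ F₂) Ψ) (hsl₁ : IsSlim D₁) (hsl₂ : IsSlim D₂) :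
    OneUniqueSquare Ψ.functor (ofFunctor Φ₁ F₁).base (ofFunctor Φ₂ F₂).base
      (thm34v_ofFunctor hF₁ hF₂ Ψ hs₁ hs₂ hB hsl₁ hsl₂).2.2.choose :=
  (thm34v_ofFunctor hF₁ hF₂ Ψ hs₁ hs₂ hB hsl₁ hsl₂).2.2.choose_spec.1

/-- **The `Ψistr` square of Thm. 3.4 (i) AT THE FROBENIOIDS and at THE isotropification functors of Prop. 1.9 (v)**:
for Frobenioids of quasi-isotropic type, the functor `Ψistr` provided by `PreFrobenioid.thm34i_istr_ofFunctor` is an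
equivalence fitting a `1`-commutative, `1`-unique square with the isotropifications. [cite: MochizukiFrdI2008, Thm. 3.4 (i) p.62] -/
theorem oneUniqueSquare_istr_ofFunctor (hF₁ : PreFrobenioid.IsFrobenioid F₁) (hF₂ : PreFrobenioid.IsFrobenioid F₂)
    (Ψ : C₁ ≌ C₂) (hq₁ : (ofFunctor Φ₁ F₁).IsOfQuasiIsotropicType) (hq₂ : (ofFunctor Φ₂ F₂).IsOfQuasiIsotropicType) :
    OneUniqueSquare Ψ.functor
      (PreFrobenioid.isotropification hF₁ ⋙ ObjectProperty.ιOfLE (PreFrobenioid.isotropicObjects_le_ofFunctor F₁))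
      (PreFrobenioid.isotropification hF₂ ⋙ ObjectProperty.ιOfLE (PreFrobenioid.isotropicObjects_le_ofFunctor F₂))
      (PreFrobenioid.thm34i_istr_ofFunctor hF₁ hF₂ Ψ hq₁ hq₂).choose :=
  (PreFrobenioid.thm34i_istr_ofFunctor hF₁ hF₂ Ψ hq₁ hq₂).choose_spec.1

/-- **The `Ψun-tr` square of Thm. 3.4 (iv) AT THE FROBENIOIDS and at THE `Ψistr`** (the restriction of `Ψ` to the
isotropic objects): for Frobenioids of quasi-isotropic type, under (a), (b) and Frobenius-slim bases, the functor
`Ψun-tr` provided by `FrdI.thm34iv_untr_ofFunctor'` is an equivalence fitting a `1`-commutative, `1`-unique square with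
the unit-trivialisation functors of Prop. 3.3 (iii). [cite: MochizukiFrdI2008, Thm. 3.4 (iv) p.63] -/
theorem oneUniqueSquare_untr_ofFunctor (hF₁ : PreFrobenioid.IsFrobenioid F₁) (hF₂ : PreFrobenioid.IsFrobenioid F₂)
    (hq₁ : (ofFunctor Φ₁ F₁).IsOfQuasiIsotropicType) (hq₂ : (ofFunctor Φ₂ F₂).IsOfQuasiIsotropicType)
    (Ψ : C₁ ≌ C₂) (hs₁ : (ofFunctor Φ₁ F₁).IsOfStandardType) (hs₂ : (ofFunctor Φ₂ F₂).IsOfStandardType)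
    (hB : HypB (ofFunctor Φ₁ F₁) (ofFunctor Φ₂ F₂) Ψ) (hfs₁ : IsFrobeniusSlim D₁) (hfs₂ : IsFrobeniusSlim D₂) :
    haveI := isClosedUnderIsomorphisms_isotropicObjects_ofFunctor (Φ₂ := Φ₂) hF₂
    OneUniqueSquare (Ψ.congrFullSubcategory (isotropicObjects_ofFunctor_inverseImage hF₁ hq₁ hq₂ Ψ)).functor
      (ofFunctor Φ₁ F₁).toUntr (ofFunctor Φ₂ F₂).toUntr
      ((thm34iv_untr_ofFunctor' hF₁ hF₂ hq₁ hq₂ Ψ hs₁ hs₂ hB hfs₁ hfs₂).choose) :=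
  (thm34iv_untr_ofFunctor' hF₁ hF₂ hq₁ hq₂ Ψ hs₁ hs₂ hB hfs₁ hfs₂).choose_spec.1

/-- **The `Ψpf` square of Thm. 3.4 (iii) AT THE FROBENIOIDS and at THE perfections of Prop. 3.2, perfect type**:
under (a) and (b), the functor `Ψpf` provided by `FrdI.thm34iii_pf_ofFunctor_of_isOfPerfectType` is an equivalence
fitting a `1`-commutative, `1`-unique square with `C_i → C_i^pf`.  (Outside perfect type the bare `1`-uniqueness of this
square is refuted, `DegreeModel.not_thm34iii_pf`; the structure-compatible square is `FrdI.thm34iii_pfSquare_of_isOfFSMFFType`.)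
[cite: MochizukiFrdI2008, Thm. 3.4 (iii) p.62] -/
theorem oneUniqueSquare_pf_ofFunctor_of_isOfPerfectType (hF₁ : PreFrobenioid.IsFrobenioid F₁)
    (hF₂ : PreFrobenioid.IsFrobenioid F₂) (hP₁ : PreFrobenioid.IsOfPerfectType F₁)
    (hP₂ : PreFrobenioid.IsOfPerfectType F₂) (Ψ : C₁ ≌ C₂)
    (hs₁ : (ofFunctor Φ₁ F₁).IsOfStandardType) (hs₂ : (ofFunctor Φ₂ F₂).IsOfStandardType)
    (hB : HypB (ofFunctor Φ₁ F₁) (ofFunctor Φ₂ F₂) Ψ) :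
    OneUniqueSquare Ψ.functor (perfection hF₁).toPf (perfection hF₂).toPf
      (thm34iii_pf_ofFunctor_of_isOfPerfectType hF₁ hF₂ hP₁ hP₂ Ψ hs₁ hs₂ hB).choose :=
  (thm34iii_pf_ofFunctor_of_isOfPerfectType hF₁ hF₂ hP₁ hP₂ Ψ hs₁ hs₂ hB).choose_spec.1

end Two

end FrdI

/-! ### F-2304 `IsFrobeniusSection` — the zero section of a model Frobenioid -/

namespace ModelFrobenioid

variable {D : Type u} [Category.{v} D] {Φ B : Dᵒᵖ ⥤ CommMonCat.{w}} {DivB : B ⟶ monoidGp Φ}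

/-- **The zero Frobenius section of a model Frobenioid IS a Frobenius section** (Def. 2.7 (ii)): for `D` skeletal,
`Φ` divisorial and `B` group-like, the Frobenius endomorphisms `(n, id, 0, 1)` of the objects `(A, 0)` form a Frobenius
section of the zero presection (proof of Thm. 5.2 (ii), p. 101; the `isFrobeniusSection` component of abc-iut-L1's
`isBaseFrobeniusPair_zero`). [cite: MochizukiFrdI2008, Thm. 5.2(ii) p.101] -/
theorem isFrobeniusSection_zero (hΦd : Objectwise (fun M _ => IsDivisorial M) Φ)
    (hBg : Objectwise (fun M _ => IsGroupLike M) B) (hD : Skeletal D) :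
    PreFrobenioid.IsFrobeniusSection (toElem Φ B DivB) (zeroPresection Φ B DivB) (zeroFrobeniusSection Φ B DivB) :=
  (isBaseFrobeniusPair_zero hΦd hBg hD).isFrobeniusSection

end ModelFrobenioid

/-! ### v2 — F-0900 `Thm34i`, F-0899 `Remark341`, F-0916 `Prop33ii`, F-0919 `Prop33v`, F-0896 `Prop311i` at the Frobenioids -/

namespace FrdI

section TwoV2

variable {D₁ : Type u} [Category.{v} D₁] {Φ₁ : D₁ᵒᵖ ⥤ CommMonCat.{w}} {C₁ : Type u'} [Category.{v'} C₁]
  {D₂ : Type u} [Category.{v} D₂] {Φ₂ : D₂ᵒᵖ ⥤ CommMonCat.{w}} {C₂ : Type u'} [Category.{v'} C₂]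
  {F₁ : C₁ ⥤ ElemFrobenioid Φ₁} {F₂ : C₂ ⥤ ElemFrobenioid Φ₂}

/-- **[FrdI] Thm. 3.4 (i), preservation part, AT THE FROBENIOIDS** (head `PreFrobenioidData.Thm34i`): for every pair of
Frobenioids and every equivalence `Ψ`, if `C₁`, `C₂` are of quasi-isotropic type then `Ψ` preserves the isotropic
objects, isotropic hulls and isometric pre-steps — the body of the tree's theorem `FrdI.Thm34i_holds`.
[cite: MochizukiFrdI2008, Thm. 3.4 (i) p.62] -/
theorem thm34i_ofFunctor (hF₁ : PreFrobenioid.IsFrobenioid F₁) (hF₂ : PreFrobenioid.IsFrobenioid F₂)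
    (Ψ : C₁ ≌ C₂) : (ofFunctor Φ₁ F₁).Thm34i (ofFunctor Φ₂ F₂) Ψ :=
  Thm34i_holds F₁ F₂ hF₁ hF₂ Ψ

/-- **[FrdI] Remark 3.4.1 AT THE FROBENIOIDS** (head `PreFrobenioidData.Remark341`): for every pair of Frobenioids and
every equivalence `Ψ` — group-like and quasi-isotropic type plus preservation of Frobenius degrees by `Ψ`, `Ψ⁻¹` give
preservation of base-isomorphisms — the body of `FrdI.Remark341_holds`. [cite: MochizukiFrdI2008, Rem. 3.4.1 p.69] -/
theorem remark341_ofFunctor (hF₁ : PreFrobenioid.IsFrobenioid F₁) (hF₂ : PreFrobenioid.IsFrobenioid F₂)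
    (Ψ : C₁ ≌ C₂) : (ofFunctor Φ₁ F₁).Remark341 (ofFunctor Φ₂ F₂) Ψ :=
  Remark341_holds F₁ F₂ hF₁ hF₂ Ψ

end TwoV2

section OneV2

variable {D : Type u} [Category.{v} D] {Φ : Dᵒᵖ ⥤ CommMonCat.{w}} {C : Type u'} [Category.{v'} C]
  {F : C ⥤ ElemFrobenioid Φ}

/-- **[FrdI] Prop. 3.3 (ii) AT THE FROBENIOIDS** (head `Frobenioids.Prop33ii`): for every Frobenioid, two co-objective
arrows of `C^istr` are unit-equivalent iff they have the same `(deg_Fr, Div, Base)` — the body of `FrdI.Prop33ii_holds`.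
[cite: MochizukiFrdI2008, Prop. 3.3 (ii) p.59] -/
theorem prop33ii_ofFunctor (hF : PreFrobenioid.IsFrobenioid F) : Frobenioids.Prop33ii (ofFunctor Φ F) :=
  Prop33ii_holds F hF

/-- **[FrdI] Prop. 3.3 (v) AT THE FROBENIOIDS** (head `Frobenioids.Prop33v`): for every Frobenioid, `C → F_Φ` is an
equivalence (arrows determined by `(Base, Div, deg_Fr)`, every triple realised, every base object reached) iff `C` is of
`Aut`-ample, unit-trivial and base-trivial type — the body of `FrdI.Prop33v_holds`. [cite: MochizukiFrdI2008, Prop. 3.3 (v) p.60] -/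
theorem prop33v_ofFunctor (hF : PreFrobenioid.IsFrobenioid F) : Frobenioids.Prop33v (ofFunctor Φ F) :=
  Prop33v_holds F hF

/-- **[FrdI] Prop. 3.11 (i) AT THE FROBENIOIDS** (head `PreFrobenioidData.Prop311i`): for every Frobenioid of isotropic,
unit-trivial and group-like type over the zero monoid on a base of FSMFF-type, `C → F_Φ` is an equivalence (unfolded
form) — the body of `FrdI.Prop311i_holds`. [cite: MochizukiFrdI2008, Prop. 3.11 (i) p.73] -/
theorem prop311i_ofFunctor (hF : PreFrobenioid.IsFrobenioid F) : (ofFunctor Φ F).Prop311i :=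
  Prop311i_holds F hF

end OneV2

end FrdI

end Literature.AlgebraicGeometry.Frobenioids
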